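import Mathlib
import Summits.Ventures.HodgeRepro2.T5InertLatticeNormalForm
import Summits.Ventures.HodgeRepro2.T5HeckeIsomorphismTransport
import Summits.Ventures.HodgeRepro2.T5GaloisCartanThree

/-!
# `H(U(V_v), K_v)` is commutative for the record's own `K_v` at every inert place

Blind cell `pub-hodge-repro2`, seat p8 (gen 13), Tier-5 kernel support.  The inert-place package
states commutativity of `H(U(2,1), K_U)` for the group `U(antidiag(1, u, 1))` and its `K_U`
(`T5GaloisCartanThree.heckeAlgebra_mul_comm_galois_of_isLocalRing`).  The record's `K_v` is the
stabiliser of a self-dual lattice in `U(H)` for the Gram matrix `H` of the record's hermitian space: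
`T5InertLatticeNormalForm` (T5-141) gives `P ∈ GL₃(𝒪_{E_v})` with `Pᴴ H P = antidiag(1, u₀, 1)`,
`u₀ ∈ 𝒪_{F_v}^×`, conjugation by `P` is `U(Pᴴ H P) ≃* U(H)` mapping `K_{Pᴴ H P}` onto `K_H`
(`T5HermitianIsotropicLattice.map_conj_hyperspecialSubgroup`), and `T5HeckeIsomorphismTransport`
(T5-142) transports commutativity along it:

* `isInteger_inv_apply_of_isRUnit_det` / `mem_range_of_isInteger_of_isRUnit_det` — an integral
  `3 × 3` matrix with unit determinant lies in the image of `GL₃(R)` (adjugate formula);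
* `heckeAlgebra_mul_comm_of_isotropic_of_unramified` — **for `H` hermitian (Galois star) with
  entries and inverse in `𝒪_{E_v}`, isotropic, and `E_v / F_v` unramified with finite residue field,
  `H(U(H), K_H)` is commutative** — the record's sentence for the record's own `K_v`.

What stays a reading: the isotropy of `V_v` (printed) and the record's choice of a self-dual `L_v`.

README §8(d): uses an L-value-free non-vanishing device: NO.
-/

namespace Summit.Ventures.HodgeRepro2.T5InertHeckeCommutative

open IsLocalRing IsLocalization Matrix T5UnitaryGroupIsometry T5IntegralUnits

section Units

variable {R E : Type*} [CommRing R] [Field E] [Algebra R E] [IsFractionRing R E]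

omit [IsFractionRing R E] in
/-- The inverse of an integral `3 × 3` matrix with unit determinant is integral
(`P⁻¹ = det⁻¹ • adj P`, the adjugate entries being determinants of integral matrices). -/
theorem isInteger_inv_apply_of_isRUnit_det {P : Matrix (Fin 3) (Fin 3) E}
    (hP : ∀ i j, IsInteger R (P i j)) (hdet : IsRUnit R P.det) (i j : Fin 3) :
    IsInteger R (P⁻¹ i j) := by
  rw [Matrix.inv_def, Ring.inverse_eq_inv', Matrix.smul_apply, smul_eq_mul, Matrix.adjugate_apply]
  refine isInteger_mul hdet.2.2 (T5HermitianIsotropicLattice.isInteger_det fun i' j' => ?_)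
  rw [Matrix.updateRow_apply]
  split_ifs
  · exact single_one_mem_stdLattice (R := R) i j'
  · exact hP i' j'

/-- An integral `3 × 3` matrix with unit determinant, as an element of the image of `GL₃(R)`. -/
theorem mem_range_of_isInteger_of_isRUnit_det {P : Matrix (Fin 3) (Fin 3) E}
    (hP : ∀ i j, IsInteger R (P i j)) (hdet : IsRUnit R P.det) :
    Matrix.GeneralLinearGroup.mk'' P (isUnit_iff_ne_zero.mpr hdet.2.1) ∈
      (Matrix.GeneralLinearGroup.map (algebraMap R E)).range := by
  refine T5UnitaryThreeCorner.mem_range_of_integral _ hP ?_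
  rw [Matrix.coe_units_inv]
  exact isInteger_inv_apply_of_isRUnit_det hP hdet

end Units

section Main

variable (R₀ F E : Type*) [CommRing R₀] [IsDomain R₀] [IsDiscreteValuationRing R₀] [Field F]
  [Field E] [Algebra R₀ F] [IsFractionRing R₀ F] [Algebra F E] [Algebra R₀ E]
  [IsScalarTower R₀ F E] [FiniteDimensional F E] [Algebra.IsSeparable F E]
  [IsLocalRing (integralClosure R₀ E)] [Finite (ResidueField R₀)]

include F in
/-- **The spherical Hecke algebra of the record's `U(V_v)` with respect to the record's `K_v` is
commutative at every inert place**: `H` hermitian for the Galois star with entries and inverse in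
`𝒪_E` (the Gram matrix of the self-dual lattice `L_v`), isotropic; `K_H = U(H) ∩ GL₃(𝒪_E)` its
stabiliser; `E / F` quadratic unramified with finite residue field.  Then `T * S = S * T` in
`H(U(H), K_H)` over any field `k`. -/
theorem heckeAlgebra_mul_comm_of_isotropic_of_unramified (h2 : Module.finrank F E = 2)
    (σ : E ≃ₐ[F] E) (hσ : σ ≠ 1)
    (hunr : (maximalIdeal R₀).map (algebraMap R₀ (integralClosure R₀ E)) =
      maximalIdeal (integralClosure R₀ E)) (H : Matrix (Fin 3) (Fin 3) E) (k : Type*) [Field k] :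
    letI := T5StarOfInvolution.starRingOfQuadratic h2 σ hσ
    H.IsHermitian → (∀ i j, IsInteger (integralClosure R₀ E) (H i j)) → IsUnit H.det →
      (∀ i j, IsInteger (integralClosure R₀ E) (H⁻¹ i j)) →
      ∀ v : Fin 3 → E, v ≠ 0 → sesqForm H v v = 0 →
      ∀ T S : T5HeckePermutationModule.heckeAlgebra k
        (T5UnitaryHeckeAdjoint.hyperspecialSubgroup (integralClosure R₀ E) H), T * S = S * T := by
  letI := T5StarOfInvolution.starRingOfQuadratic h2 σ hσ
  intro hH hHint hHdet hHinv v hv hv0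
  obtain ⟨P, hP, hPdet, u₀, hPHP⟩ :=
    T5InertLatticeNormalForm.exists_congruent_J3_integral_of_isotropic_of_unramified' R₀ F E h2 σ
      hσ hunr H hH hHint hHdet hHinv v hv hv0
  haveI := T5ResidueFieldFinite.finite_residueField_integralClosure R₀ F E
  haveI : IsFractionRing (integralClosure R₀ E) E :=
    integralClosure.isFractionRing_of_finite_extension F E
  -- the package's commutativity for `antidiag(1, u₀, 1)`
  have hcomm := T5GaloisCartanThree.heckeAlgebra_mul_comm_galois_of_isLocalRing (R₀ := R₀)
    (F := F) (E := E) σ (T5QuadraticAutomorphism.apply_apply h2 σ hσ) hunr u₀ k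
  rw [← hPHP] at hcomm
  -- transport along `U(Pᴴ H P) ≃* U(H)`
  set P' : GL (Fin 3) E := Matrix.GeneralLinearGroup.mk'' P (isUnit_iff_ne_zero.mpr hPdet.2.1)
  have hP' : P' ∈ (Matrix.GeneralLinearGroup.map (algebraMap (integralClosure R₀ E) E)).range :=
    mem_range_of_isInteger_of_isRUnit_det hP hPdet
  have hmap := T5HermitianIsotropicLattice.map_conj_hyperspecialSubgroup (R := integralClosure R₀ E)
    H P' hP'
  refine T5HeckeIsomorphismTransport.heckeAlgebra_mul_comm_of_mulEquiv k
    (T5HermitianIsotropicForm.formUnitaryGroupMulEquiv_conj H P') (fun g => ?_) hcomm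
  rw [← hmap]
  exact (Subgroup.mem_map_iff_mem (T5HermitianIsotropicForm.formUnitaryGroupMulEquiv_conj H P').injective).symm

end Main

end Summit.Ventures.HodgeRepro2.T5InertHeckeCommutative
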